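import Literature.Topology.FourManifolds.SpikedLoopLocal
import HarnessLib

/-!
# The spiked loop: disjointness from the rest of the knot and the isotopy

Topic `Literature/Topology/FourManifolds` (trunk T-4MAN). Fact seat
`provefact-Literature.Topology.FourManifolds.Knot.IsConnectedSum.isIsotopic` (Schubert's theorem),
stage S1 of the proof of the geometric heart for rail knots. Continuing `SpikedLoopLocal.lean`: the
spiked pieces avoid the rest of the necked rail loop, in three regimes — on the same core within
the blown-up range `[-A, A]` by the strict monotonicity of the first blow-up coordinate; on the
core beyond that range but inside the flatness ball by the quantitative lower bound
`‖Fband q - pZero‖ ≥ (1 - ε) ‖q‖ / ‖frame⁻¹‖` against the `O(κ)` size of the pieces (this is what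
fixes `A` in terms of the condition number of the frame); and everywhere else by compactness (the
rest of the loop stays at positive distance from the crossing point, uniformly in `κ`). With the
modification lemma of `CurveFamilyIsotopy.lean` this gives the **spiked knot** and its isotopy
with the necked rail knot, under explicit smallness hypotheses on `κ` collected in
`BandData.SpikeScale`, which are shown to hold for all small `κ`.

Main results: `b.farSet ρ` and `exists_farDist`; `le_norm_Fband_sub_pZero` (flat lower bound);
`BandData.SpikeScale` (the smallness hypotheses) and `exists_spikeScale` (they hold for all small
`κ > 0`, for any sign `|σ| ≤ 1`); `spikePiece_ne_neckPiece` (disjointness);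
`isRegularLoop_spikeLoop`, `injOn_spikePiece_Ico`, `b.spikeKnot h hAB`,
`isIsotopic_neckKnot_spikeKnot` and `isIsotopic_railKnot_spikeKnot`.

Everything is proved; no named facts are introduced.

## References

* M. W. Hirsch, *Differential Topology*, GTM 33, Springer (1976), Ch. 8 §1, Thm. 1.3 (isotopy
  extension). [HirschDT1976]
-/

open scoped Manifold ContDiff Topology Real
open Function Set Metric Filter

noncomputable section

namespace Literature.Topology.FourManifolds

/-- Local notation: `𝔼 n` is the model Euclidean space `EuclideanSpace ℝ (Fin n)`. -/
local notation "𝔼 " n:arg => EuclideanSpace ℝ (Fin n)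

/-- Local notation: `𝕊 n` is the unit sphere in `EuclideanSpace ℝ (Fin (n + 1))`. -/
local notation "𝕊 " n:arg => (Metric.sphere (0 : EuclideanSpace ℝ (Fin (n + 1))) 1)

attribute [local instance] fact_finrank_euclideanSpace_succ

open KnotsInBall

namespace BandData

variable {A B K : Knot} {avoid : Set (𝕊 3)} (b : BandData A B K avoid)
  (hcross : b.band ⁻¹' sphereEquator 2 ∩ squareNhd b.δ = {x ∈ squareNhd b.δ | x 0 = 2⁻¹})

/-! ### The far set: where the rest of the loop lives, uniformly in `κ` -/

omit b in
/-- The far planar set: points of the closed collar strip `[0, 1] × [1/10, 9/10]` at distance at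
least `ρ` from the centre. [folklore] -/
def farPlanar (ρ : ℝ) : Set (𝔼 2) :=
  {p | p 0 ∈ Icc (0 : ℝ) 1 ∧ p 1 ∈ Icc (10⁻¹ : ℝ) (9 / 10) ∧ ρ ≤ ‖p - pt2 2⁻¹ 2⁻¹‖}

omit b in
/-- The far planar set is compact (closed and bounded). [folklore] -/
theorem isCompact_farPlanar (ρ : ℝ) : IsCompact (farPlanar ρ) := by
  refine Metric.isCompact_of_isClosed_isBounded ?_ ?_
  · have h0 : Continuous fun p : 𝔼 2 ↦ p 0 := (EuclideanSpace.proj (0 : Fin 2)).continuous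
    have h1 : Continuous fun p : 𝔼 2 ↦ p 1 := (EuclideanSpace.proj (1 : Fin 2)).continuous
    have hn : Continuous fun p : 𝔼 2 ↦ ‖p - pt2 2⁻¹ 2⁻¹‖ := continuous_norm.comp (continuous_id.sub continuous_const)
    exact (isClosed_Icc.preimage h0).inter ((isClosed_Icc.preimage h1).inter (isClosed_le continuous_const hn))
  · refine (Metric.isBounded_closedBall (x := (0 : 𝔼 2)) (r := 2)).subset fun p hp ↦ ?_
    rw [mem_closedBall, dist_zero_right]
    have e : p = pt2 (p 0) (p 1) := by ext i; fin_cases i <;> rfl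
    rw [e]
    refine (norm_pt2_le _ _).trans ?_
    rw [abs_of_nonneg hp.1.1, abs_of_nonneg (by linarith [hp.2.1.1])]
    linarith [hp.1.2, hp.2.1.2]

/-- The far planar set lies in the open collar square. [folklore] -/
theorem farPlanar_subset_squareNhd (ρ : ℝ) : farPlanar ρ ⊆ squareNhd b.δ := by
  intro p hp
  have hδ := b.δ_pos
  rw [mem_squareNhd_iff, Fin.forall_fin_two]
  exact ⟨⟨by linarith [hp.1.1], by linarith [hp.1.2]⟩, ⟨by linarith [hp.2.1.1], by linarith [hp.2.1.2]⟩⟩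

/-- **The far set** in `ℝ⁴`: the rail loop's fundamental arc together with the band image of the
far planar set. [folklore] -/
def farSet (ρ : ℝ) : Set (𝔼 4) :=
  b.railPiece '' Icc b.alo (b.alo + 1) ∪ (fun p ↦ ((b.band p : 𝕊 3) : 𝔼 4)) '' farPlanar ρ

/-- The far set is compact. [folklore] -/
theorem isCompact_farSet (ρ : ℝ) : IsCompact (b.farSet ρ) :=
  (isCompact_Icc.image b.contDiff_railPiece.continuous).union
    ((isCompact_farPlanar ρ).image b.contDiff_coe_band.continuous)

/-- The crossing point is not on the rail loop's fundamental arc. [folklore] -/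
theorem railPiece_ne_crossPt {t : ℝ} (ht : t ∈ Icc b.alo (b.alo + 1)) :
    b.railPiece t ≠ ((b.crossPt : 𝕊 3) : 𝔼 4) := by
  have hc := b.centre_mem_squareNhd
  have hA : b.crossPt ∉ range A := b.band_not_mem_range_A hc (by simp)
  have hB : b.crossPt ∉ range B := b.band_not_mem_range_B hc (by norm_num)
  intro h
  rcases ht.2.eq_or_lt with he | hlt
  · -- `t = alo + 1`: by the seam this is the value at `alo`, of type A
    have hs : b.railPiece t = b.railPiece b.alo := by
      have := b.railPiece_seam b.alo ⟨by linarith [b.seamEps_bounds.1], by linarith [b.seamEps_bounds.1]⟩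
      rw [he, this]
    rw [hs, b.railPiece_typeA ⟨le_rfl, by linarith⟩ (Or.inl (by linarith [b.epsLo_bounds.1])), Knot.curve_apply] at h
    exact hA ⟨_, Subtype.ext h⟩
  have ht' : t ∈ Ico b.alo (b.alo + 1) := ⟨ht.1, hlt⟩
  rcases b.kind_cases t with hk | hk | hk | hk
  · rw [b.railPiece_typeA ht' hk, Knot.curve_apply] at h
    exact hA ⟨_, Subtype.ext h⟩
  · rw [b.railPiece_typeB hk, Knot.curve_apply] at h
    exact hB ⟨_, Subtype.ext h⟩
  · obtain ⟨he, hU, -, h1, -, -⟩ := b.railPiece_typeO_lo hk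
    rw [he] at h
    have e1 := congrArg (fun p : 𝔼 2 ↦ p 1) (b.injOn hU hc (Subtype.ext h))
    change b.railLo t 1 = (2⁻¹ : ℝ) at e1
    linarith
  · obtain ⟨he, hU, -, h1, -, -⟩ := b.railPiece_typeO_hi hk
    rw [he] at h
    have e1 := congrArg (fun p : 𝔼 2 ↦ p 1) (b.injOn hU hc (Subtype.ext h))
    change b.railUp t 1 = (2⁻¹ : ℝ) at e1
    linarith

/-- The band image of a far planar point is not the crossing point (for `ρ > 0`). [folklore] -/
theorem band_farPlanar_ne_crossPt {ρ : ℝ} (hρ : 0 < ρ) {p : 𝔼 2} (hp : p ∈ farPlanar ρ) :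
    ((b.band p : 𝕊 3) : 𝔼 4) ≠ ((b.crossPt : 𝕊 3) : 𝔼 4) := by
  intro h
  have := b.injOn (b.farPlanar_subset_squareNhd ρ hp) b.centre_mem_squareNhd (Subtype.ext h)
  have h2 := hp.2.2
  rw [this, sub_self, norm_zero] at h2
  linarith

/-- **The far set stays at positive distance from the crossing point.** [folklore] -/
theorem exists_farDist {ρ : ℝ} (hρ : 0 < ρ) :
    ∃ m > 0, ∀ z ∈ b.farSet ρ, m ≤ ‖z - ((b.crossPt : 𝕊 3) : 𝔼 4)‖ := by
  set c : 𝔼 4 := ((b.crossPt : 𝕊 3) : 𝔼 4)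
  have hK := b.isCompact_farSet ρ
  have hnot : c ∉ b.farSet ρ := by
    rintro (⟨t, ht, h⟩ | ⟨p, hp, h⟩)
    · exact b.railPiece_ne_crossPt ht h
    · exact b.band_farPlanar_ne_crossPt hρ hp h
  rcases (b.farSet ρ).eq_empty_or_nonempty with he | hne
  · exact ⟨1, one_pos, fun z hz ↦ by rw [he] at hz; exact hz.elim⟩
  obtain ⟨z₀, hz₀, hmin⟩ := hK.exists_isMinOn hne (continuous_norm.comp (continuous_id.sub continuous_const)).continuousOn
  refine ⟨‖z₀ - c‖, norm_pos_iff.2 (sub_ne_zero.2 fun h ↦ hnot (h ▸ hz₀)), fun z hz ↦ hmin hz⟩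

/-! ### Where the necked loop is, relative to the far set -/

/-- Off the neck set the necked piece function takes values in the far set. [folklore] -/
theorem neckPiece_mem_farSet_of_not_mem {κ : ℝ} (ρ : ℝ) {t : ℝ} (ht : t ∈ Icc b.alo (b.alo + 1))
    (hn : t ∉ b.neckSet) : b.neckPiece κ 1 t ∈ b.farSet ρ := by
  rw [b.neckPiece_eq_railPiece hn]
  exact Or.inl ⟨t, ht, rfl⟩

/-- On the lower window, the necked lower arch point: first coordinate `χ₁ t`, height in
`[1/4, 1/2 - κ]`, inside the square. [folklore] -/
theorem neckLo_window {κ : ℝ} (hκ4 : κ ≤ 1 / 4) {t : ℝ}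
    (ht : t ∈ Icc (b.tcLo - b.epsLo / 2) (b.tcLo + b.epsLo / 2)) :
    b.neckLo κ 1 t 0 = b.chiLo t ∧ b.neckLo κ 1 t 1 ∈ Icc (1 / 4 : ℝ) (1 / 2 - κ) ∧
      b.neckLo κ 1 t 0 ∈ Icc (0 : ℝ) 1 := by
  refine ⟨?_, b.neckLo_one_mem hκ4 ⟨zero_le_one, le_rfl⟩ ht, ?_⟩
  · rw [neckLo_apply_zero, railLo_apply_zero]; rfl
  · rw [neckLo_apply_zero]; exact b.railLo_zero_mem_Icc t

/-- On the upper window, the necked upper arch point. [folklore] -/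
theorem neckUp_window {κ : ℝ} (hκ4 : κ ≤ 1 / 4) {t : ℝ}
    (ht : t ∈ Icc (b.tcHi - b.epsHi / 2) (b.tcHi + b.epsHi / 2)) :
    b.neckUp κ 1 t 0 = b.chiHi t ∧ b.neckUp κ 1 t 1 ∈ Icc (1 / 2 + κ : ℝ) (3 / 4) ∧
      b.neckUp κ 1 t 0 ∈ Icc (0 : ℝ) 1 := by
  refine ⟨?_, b.neckUp_one_mem hκ4 ⟨zero_le_one, le_rfl⟩ ht, ?_⟩
  · rw [neckUp_apply_zero, railUp_apply_zero]; rfl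
  · rw [neckUp_apply_zero]; exact b.railUp_zero_mem_Icc t

/-- On the lower window off the open lower core, the necked piece function is in the far set of
radius `ρ ≤ gapLo`. [folklore] -/
theorem neckPiece_mem_farSet_lowerWindow {κ ρ : ℝ} (hκ4 : κ ≤ 1 / 4) (hκ0 : 0 < κ) (hρ : ρ ≤ b.gapLo) {t : ℝ}
    (ht : t ∈ Icc (b.tcLo - b.epsLo / 2) (b.tcLo + b.epsLo / 2))
    (hnc : t ∉ Ioo (b.tcLo - b.epsLo / 8) (b.tcLo + b.epsLo / 8)) : b.neckPiece κ 1 t ∈ b.farSet ρ := by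
  rw [b.neckPiece_of_mem_lower ht]
  refine Or.inr ⟨b.neckLo κ 1 t, ?_, rfl⟩
  obtain ⟨h0, h1, h01⟩ := b.neckLo_window hκ4 ht
  refine ⟨h01, ⟨by linarith [h1.1], by linarith [h1.2]⟩, ?_⟩
  have hfar : b.gapLo ≤ |b.chiLo t - 1 / 2| := not_lt.1 fun h ↦ hnc (b.mem_coreLo_of_abs_lt h)
  calc ρ ≤ |b.chiLo t - 1 / 2| := hρ.trans hfar
    _ = |(b.neckLo κ 1 t - pt2 2⁻¹ 2⁻¹) 0| := by rw [PiLp.sub_apply, h0]; norm_num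
    _ ≤ ‖b.neckLo κ 1 t - pt2 2⁻¹ 2⁻¹‖ := by simpa [Real.norm_eq_abs] using PiLp.norm_apply_le (b.neckLo κ 1 t - pt2 2⁻¹ 2⁻¹) 0

/-- On the upper window off the open upper core, the necked piece function is in the far set of
radius `ρ ≤ gapHi`. [folklore] -/
theorem neckPiece_mem_farSet_upperWindow {κ ρ : ℝ} (hκ4 : κ ≤ 1 / 4) (hκ0 : 0 < κ) (hρ : ρ ≤ b.gapHi) {t : ℝ}
    (ht : t ∈ Icc (b.tcHi - b.epsHi / 2) (b.tcHi + b.epsHi / 2))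
    (hnc : t ∉ Ioo (b.tcHi - b.epsHi / 8) (b.tcHi + b.epsHi / 8)) : b.neckPiece κ 1 t ∈ b.farSet ρ := by
  rw [b.neckPiece_of_mem_upper ht]
  refine Or.inr ⟨b.neckUp κ 1 t, ?_, rfl⟩
  obtain ⟨h0, h1, h01⟩ := b.neckUp_window hκ4 ht
  refine ⟨h01, ⟨by linarith [h1.1], by linarith [h1.2]⟩, ?_⟩
  have hfar : b.gapHi ≤ |b.chiHi t - 1 / 2| := not_lt.1 fun h ↦ hnc (b.mem_coreHi_of_abs_lt h)
  calc ρ ≤ |b.chiHi t - 1 / 2| := hρ.trans hfar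
    _ = |(b.neckUp κ 1 t - pt2 2⁻¹ 2⁻¹) 0| := by rw [PiLp.sub_apply, h0]; norm_num
    _ ≤ ‖b.neckUp κ 1 t - pt2 2⁻¹ 2⁻¹‖ := by simpa [Real.norm_eq_abs] using PiLp.norm_apply_le (b.neckUp κ 1 t - pt2 2⁻¹ 2⁻¹) 0

/-- On the closed lower core, if the rail parameter point is outside the ball of radius `ρ`, the
necked piece function is in the far set of radius `ρ`. [folklore] -/
theorem neckPiece_mem_farSet_coreLo {κ ρ : ℝ} (hκ4 : κ ≤ 1 / 4) (hκ0 : 0 < κ) {t : ℝ}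
    (ht : t ∈ Icc (b.tcLo - b.epsLo / 8) (b.tcLo + b.epsLo / 8))
    (hq : ρ ≤ ‖(pt2 (κ * b.alphaLo κ t) (-κ) : 𝔼 2)‖) : b.neckPiece κ 1 t ∈ b.farSet ρ := by
  have hε := b.epsLo_bounds.1
  have htw : t ∈ Icc (b.tcLo - b.epsLo / 2) (b.tcLo + b.epsLo / 2) := ⟨by linarith [ht.1], by linarith [ht.2]⟩
  rw [b.neckPiece_coreLo ht]
  refine Or.inr ⟨_, ⟨?_, ?_, ?_⟩, rfl⟩
  · have := (b.neckLo_window hκ4 htw).2.2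
    rwa [(b.neckLo_window hκ4 htw).1] at this
  · change (1 / 2 - κ : ℝ) ∈ Icc (10⁻¹ : ℝ) (9 / 10); constructor <;> linarith
  · rw [← b.centre_add_railLoParam hκ0.ne' t, add_sub_cancel_left]; exact hq

/-- On the closed upper core, if the rail parameter point is outside the ball of radius `ρ`, the
necked piece function is in the far set of radius `ρ`. [folklore] -/
theorem neckPiece_mem_farSet_coreHi {κ ρ : ℝ} (hκ4 : κ ≤ 1 / 4) (hκ0 : 0 < κ) {t : ℝ}
    (ht : t ∈ Icc (b.tcHi - b.epsHi / 8) (b.tcHi + b.epsHi / 8))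
    (hq : ρ ≤ ‖(pt2 (κ * b.alphaHi κ t) κ : 𝔼 2)‖) : b.neckPiece κ 1 t ∈ b.farSet ρ := by
  have hε := b.epsHi_bounds.1
  have htw : t ∈ Icc (b.tcHi - b.epsHi / 2) (b.tcHi + b.epsHi / 2) := ⟨by linarith [ht.1], by linarith [ht.2]⟩
  rw [b.neckPiece_coreHi ht]
  refine Or.inr ⟨_, ⟨?_, ?_, ?_⟩, rfl⟩
  · have := (b.neckUp_window hκ4 htw).2.2
    rwa [(b.neckUp_window hκ4 htw).1] at this
  · change (1 / 2 + κ : ℝ) ∈ Icc (10⁻¹ : ℝ) (9 / 10); constructor <;> linarith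
  · rw [← b.centre_add_railHiParam hκ0.ne' t, add_sub_cancel_left]; exact hq

/-! ### Quantitative separation in the flat regime -/

omit b in
/-- The embedding `q ↦ (q₀, q₁, 0)` is norm-preserving. [folklore] -/
theorem norm_inl_eq (q : 𝔼 2) : ‖(WithLp.toLp 2 ![q 0, q 1, 0] : 𝔼 3)‖ = ‖q‖ := by
  rw [EuclideanSpace.norm_eq, EuclideanSpace.norm_eq]
  congr 1
  simp [Fin.sum_univ_three, Fin.sum_univ_two]

/-- **Lower bound in the flat regime**: `‖frame⁻¹‖ ‖Fband q - pZero‖ ≥ (1 - ε) ‖q‖` for `‖q‖ < r`.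
[folklore] -/
theorem le_norm_Fband_sub_pZero {ε r : ℝ} (hf : b.IsFlat hcross ε r) {q : 𝔼 2} (hq : ‖q‖ < r) :
    (1 - ε) * ‖q‖ ≤ ‖((b.frame hcross).symm : (𝔼 3) →L[ℝ] 𝔼 3)‖ * ‖b.Fband q - b.pZero‖ := by
  have key := hf.flat q 0 hq (by simpa using hf.r_pos)
  have hF0 : b.Fband 0 = b.pZero := rfl
  rw [hF0, sub_zero] at key
  set v := (b.frame hcross).symm (b.Fband q - b.pZero)
  have hι : ‖(WithLp.toLp 2 ![q 0 - (0 : 𝔼 2) 0, q 1 - (0 : 𝔼 2) 1, 0] : 𝔼 3)‖ = ‖q‖ := by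
    have := norm_inl_eq q; simpa using this
  have h1 : ‖q‖ - ε * ‖q‖ ≤ ‖v‖ := by
    have := norm_sub_norm_le (WithLp.toLp 2 ![q 0 - (0 : 𝔼 2) 0, q 1 - (0 : 𝔼 2) 1, 0] : 𝔼 3) v
    rw [hι] at this
    have h2 : ‖(WithLp.toLp 2 ![q 0 - (0 : 𝔼 2) 0, q 1 - (0 : 𝔼 2) 1, 0] : 𝔼 3) - v‖ ≤ ε * ‖q‖ := by
      rw [norm_sub_rev]; exact key
    linarith
  have h3 : ‖v‖ ≤ ‖((b.frame hcross).symm : (𝔼 3) →L[ℝ] 𝔼 3)‖ * ‖b.Fband q - b.pZero‖ :=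
    ((b.frame hcross).symm : (𝔼 3) →L[ℝ] 𝔼 3).le_opNorm _
  linarith

/-- The rail parameter point has norm at least `κ |α|`. [folklore] -/
theorem mul_abs_le_norm_railParam (κ α s : ℝ) : |κ| * |α| ≤ ‖(pt2 (κ * α) s : 𝔼 2)‖ := by
  have := PiLp.norm_apply_le (pt2 (κ * α) s : 𝔼 2) 0
  simpa [Real.norm_eq_abs, abs_mul] using this

/-! ### The smallness hypotheses on the scale -/

/-- **The scale hypotheses for the spike construction** at sign `σ`, tolerance `ε`, flatness
radius `r`, blown-up range `A'` and scale `κ`. [folklore] -/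
structure SpikeScale (σ ε r A' κ : ℝ) : Prop where
  flat : b.IsFlat hcross ε r
  κ_pos : 0 < κ
  κ_le : κ ≤ 1 / 12
  abs_σ_le : |σ| ≤ 1
  seven_le : 7 ≤ A'
  scale_lt_r : κ * (A' + 1) < r
  scale_le_gapLo : κ * (A' + 1) ≤ b.gapLo
  scale_le_gapHi : κ * (A' + 1) ≤ b.gapHi
  good : ε * (1 + bumpBound * (A' + 1)) ≤ 1 / 2
  eps_le : ε * (A' + 1) ≤ 5 / 6
  big : 9 * ‖((b.frame hcross : (𝔼 3) ≃L[ℝ] 𝔼 3) : (𝔼 3) →L[ℝ] 𝔼 3)‖ *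
      ‖((b.frame hcross).symm : (𝔼 3) →L[ℝ] 𝔼 3)‖ < (1 - ε) * A'
  far : ∃ m ρ₀ : ℝ, (∀ z ∈ b.farSet (min r (min b.gapLo b.gapHi)), m ≤ ‖z - ((b.crossPt : 𝕊 3) : 𝔼 4)‖) ∧
      (∀ y : 𝔼 3, ‖y - b.pZero‖ < ρ₀ → ‖((psiN.symm y : 𝕊 3) : 𝔼 4) - ((b.crossPt : 𝕊 3) : 𝔼 4)‖ < m) ∧
      9 * κ * ‖((b.frame hcross : (𝔼 3) ≃L[ℝ] 𝔼 3) : (𝔼 3) →L[ℝ] 𝔼 3)‖ < ρ₀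

namespace SpikeScale

variable {b hcross} {σ ε r A' κ : ℝ} (h : b.SpikeScale hcross σ ε r A' κ)
include h

/-- `8κ < r`. [folklore] -/
theorem eight_lt_r : 8 * κ < r := by
  have := h.scale_lt_r; have := h.seven_le; have := h.κ_pos; nlinarith

/-- `8κ ≤ poleRad`. [folklore] -/
theorem eight_le_poleRad : 8 * κ ≤ b.poleRad hcross := (h.eight_lt_r.le).trans h.flat.r_le

/-- `7κ ≤ gapLo`. [folklore] -/
theorem seven_le_gapLo : 7 * κ ≤ b.gapLo := by
  have := h.scale_le_gapLo; have := h.seven_le; have := h.κ_pos; nlinarith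

/-- `7κ ≤ gapHi`. [folklore] -/
theorem seven_le_gapHi : 7 * κ ≤ b.gapHi := by
  have := h.scale_le_gapHi; have := h.seven_le; have := h.κ_pos; nlinarith

/-- `ε (1 + 8 B) ≤ 1/2`. [folklore] -/
theorem good8 : ε * (1 + bumpBound * 8) ≤ 1 / 2 := by
  have := h.good; have := h.seven_le; have hε := h.flat.eps_nonneg; have hB := bumpBound_spec.1
  nlinarith [mul_nonneg (mul_nonneg hε hB) (by linarith : (0:ℝ) ≤ A' + 1 - 8)]

/-- `8 ε ≤ 5/6`. [folklore] -/
theorem eps8 : ε * 8 ≤ 5 / 6 := by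
  have := h.eps_le; have := h.seven_le; have hε := h.flat.eps_nonneg
  nlinarith

/-- `κ ≤ 1/4`. [folklore] -/
theorem κ_le_quarter : κ ≤ 1 / 4 := by linarith [h.κ_le]

/-- `ε ≤ 1/2`. [folklore] -/
theorem eps_le_half : ε ≤ 1 / 2 := by
  have := h.good; have hε := h.flat.eps_nonneg; have hB := bumpBound_spec.1
  have : 0 ≤ ε * (bumpBound * (A' + 1)) := mul_nonneg hε (mul_nonneg hB (by linarith [h.seven_le]))
  nlinarith

end SpikeScale

/-! ### The new points are close to the crossing point -/

section Scale

variable {hcross} {σ ε r A' κ : ℝ} (h : b.SpikeScale hcross σ ε r A' κ)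
include h

/-- The lower new point's chart value is within `9κ ‖frame‖` of `pZero` (for `s` in the lower
spike set). [folklore] -/
theorem norm_pieceLo_sub_pZero_le {u s : ℝ} (hu : u ∈ Icc (0 : ℝ) 1) (hs : b.alphaLo κ s ∈ Icc (-1 : ℝ) 6) :
    ‖b.pieceLo hcross κ σ u (b.alphaLo κ s) - b.pZero‖ ≤
      9 * κ * ‖((b.frame hcross : (𝔼 3) ≃L[ℝ] 𝔼 3) : (𝔼 3) →L[ℝ] 𝔼 3)‖ := by
  have hα7 := b.abs_alphaLo_lt_of_mem hs
  have hsc : κ * (|b.alphaLo κ s| + 1) < r := scale_of_abs_lt h.κ_pos h.eight_lt_r hα7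
  have hε1 : ε * (|b.alphaLo κ s| + 1) ≤ 1 := by
    have := h.eps8; have hε := h.flat.eps_nonneg; nlinarith
  have h1 := b.norm_sub_pZero_le h.κ_pos (hcross := hcross) (b.pieceLo hcross κ σ u (b.alphaLo κ s))
  have h2 := b.norm_blowUp_pieceLo_le h.flat h.κ_pos hu σ hsc hε1
  have h6 : |b.alphaLo κ s| ≤ 6 := abs_le.2 ⟨by linarith [hs.1], hs.2⟩
  have h3 : |b.alphaLo κ s| + 2 + |σ| ≤ 9 := by linarith [h.abs_σ_le]
  calc _ ≤ κ * ‖((b.frame hcross : (𝔼 3) ≃L[ℝ] 𝔼 3) : (𝔼 3) →L[ℝ] 𝔼 3)‖ * ‖b.blowUp hcross κ (b.pieceLo hcross κ σ u (b.alphaLo κ s))‖ := h1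
    _ ≤ κ * ‖((b.frame hcross : (𝔼 3) ≃L[ℝ] 𝔼 3) : (𝔼 3) →L[ℝ] 𝔼 3)‖ * 9 := by
        gcongr
        · exact mul_nonneg h.κ_pos.le (norm_nonneg _)
        · linarith
    _ = _ := by ring

/-- The upper new point's chart value is within `9κ ‖frame‖` of `pZero`. [folklore] -/
theorem norm_pieceHi_sub_pZero_le {u s : ℝ} (hu : u ∈ Icc (0 : ℝ) 1) (hs : b.alphaHi κ s ∈ Icc (-1 : ℝ) 6) :
    ‖b.pieceHi hcross κ σ u (b.alphaHi κ s) - b.pZero‖ ≤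
      9 * κ * ‖((b.frame hcross : (𝔼 3) ≃L[ℝ] 𝔼 3) : (𝔼 3) →L[ℝ] 𝔼 3)‖ := by
  have hα7 := b.abs_alphaHi_lt_of_mem hs
  have hsc : κ * (|b.alphaHi κ s| + 1) < r := scale_of_abs_lt h.κ_pos h.eight_lt_r hα7
  have hε1 : ε * (|b.alphaHi κ s| + 1) ≤ 1 := by
    have := h.eps8; have hε := h.flat.eps_nonneg; nlinarith
  have h1 := b.norm_sub_pZero_le h.κ_pos (hcross := hcross) (b.pieceHi hcross κ σ u (b.alphaHi κ s))
  have h2 := b.norm_blowUp_pieceHi_le h.flat h.κ_pos hu σ hsc hε1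
  have h6 : |b.alphaHi κ s| ≤ 6 := abs_le.2 ⟨by linarith [hs.1], hs.2⟩
  have h3 : |b.alphaHi κ s| + 2 + |σ| ≤ 9 := by linarith [h.abs_σ_le]
  calc _ ≤ κ * ‖((b.frame hcross : (𝔼 3) ≃L[ℝ] 𝔼 3) : (𝔼 3) →L[ℝ] 𝔼 3)‖ * ‖b.blowUp hcross κ (b.pieceHi hcross κ σ u (b.alphaHi κ s))‖ := h1
    _ ≤ κ * ‖((b.frame hcross : (𝔼 3) ≃L[ℝ] 𝔼 3) : (𝔼 3) →L[ℝ] 𝔼 3)‖ * 9 := by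
        gcongr
        · exact mul_nonneg h.κ_pos.le (norm_nonneg _)
        · linarith
    _ = _ := by ring

/-- **The new point**: for `s` in the spike set, the spiked piece function is `ψ⁻¹ y` for a chart
point `y` within `9κ ‖frame‖` of `pZero`, namely the lower or upper piece. [folklore] -/
theorem spikePiece_eq_of_mem {u s : ℝ} (hu : u ∈ Icc (0 : ℝ) 1) (hs : s ∈ b.spikeSet κ) :
    ∃ y : 𝔼 3, b.spikePiece hcross κ σ u s = ((psiN.symm y : 𝕊 3) : 𝔼 4) ∧
      ‖y - b.pZero‖ ≤ 9 * κ * ‖((b.frame hcross : (𝔼 3) ≃L[ℝ] 𝔼 3) : (𝔼 3) →L[ℝ] 𝔼 3)‖ ∧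
      ((s ∈ Icc (b.tcLo - b.epsLo / 8) (b.tcLo + b.epsLo / 8) ∧ b.alphaLo κ s ∈ Icc (-1 : ℝ) 6 ∧
          y = b.pieceLo hcross κ σ u (b.alphaLo κ s)) ∨
        (s ∈ Icc (b.tcHi - b.epsHi / 8) (b.tcHi + b.epsHi / 8) ∧ b.alphaHi κ s ∈ Icc (-1 : ℝ) 6 ∧
          y = b.pieceHi hcross κ σ u (b.alphaHi κ s))) := by
  rcases hs with ⟨hc, hα⟩ | ⟨hc, hα⟩
  · refine ⟨_, b.spikePiece_coreLo hcross h.κ_pos h.κ_le h.eight_le_poleRad σ u hc (b.abs_alphaLo_lt_of_mem hα),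
      b.norm_pieceLo_sub_pZero_le h hu hα, Or.inl ⟨hc, hα, rfl⟩⟩
  · refine ⟨_, b.spikePiece_coreHi hcross h.κ_pos h.κ_le h.eight_le_poleRad σ u hc (b.abs_alphaHi_lt_of_mem hα),
      b.norm_pieceHi_sub_pZero_le h hu hα, Or.inr ⟨hc, hα, rfl⟩⟩

/-- On the closed lower core in the flat regime, the necked piece function is `ψ⁻¹ (railLoPsi κ (α t))`.
[folklore] -/
theorem neckPiece_eq_coreLo_flat {t : ℝ} (ht : t ∈ Icc (b.tcLo - b.epsLo / 8) (b.tcLo + b.epsLo / 8))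
    (hq : ‖(pt2 (κ * b.alphaLo κ t) (-κ) : 𝔼 2)‖ < r) :
    b.neckPiece κ 1 t = ((psiN.symm (b.railLoPsi κ (b.alphaLo κ t)) : 𝕊 3) : 𝔼 4) := by
  have hne := b.band_ne_northPole_of_norm_lt hcross (hq.trans_le h.flat.r_le)
  rw [railLoPsi, Fband, psiN_symm_apply_psiN hne, b.centre_add_railLoParam h.κ_pos.ne', b.neckPiece_coreLo ht]

/-- On the closed upper core in the flat regime, the necked piece function is `ψ⁻¹ (railHiPsi κ (α t))`.
[folklore] -/
theorem neckPiece_eq_coreHi_flat {t : ℝ} (ht : t ∈ Icc (b.tcHi - b.epsHi / 8) (b.tcHi + b.epsHi / 8))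
    (hq : ‖(pt2 (κ * b.alphaHi κ t) κ : 𝔼 2)‖ < r) :
    b.neckPiece κ 1 t = ((psiN.symm (b.railHiPsi κ (b.alphaHi κ t)) : 𝕊 3) : 𝔼 4) := by
  have hne := b.band_ne_northPole_of_norm_lt hcross (hq.trans_le h.flat.r_le)
  rw [railHiPsi, Fband, psiN_symm_apply_psiN hne, b.centre_add_railHiParam h.κ_pos.ne', b.neckPiece_coreHi ht]

/-- **Far-regime separation**: a chart point within `9κ‖frame‖` of `pZero` never maps under `ψ⁻¹`
into the far set of radius `min r (min gapLo gapHi)`. [folklore] -/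
theorem psiN_symm_not_mem_farSet {y : 𝔼 3}
    (hy : ‖y - b.pZero‖ ≤ 9 * κ * ‖((b.frame hcross : (𝔼 3) ≃L[ℝ] 𝔼 3) : (𝔼 3) →L[ℝ] 𝔼 3)‖) :
    ((psiN.symm y : 𝕊 3) : 𝔼 4) ∉ b.farSet (min r (min b.gapLo b.gapHi)) := by
  obtain ⟨m, ρ₀, hm, hρ₀, hκρ⟩ := h.far
  intro hmem
  have h1 := hm _ hmem
  have h2 := hρ₀ y (lt_of_le_of_lt hy hκρ)
  linarith

/-- **Flat-regime separation beyond the blown-up range**: a rail point `Fband q` with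
`κ A' < ‖q‖ < r` is farther from `pZero` than `9κ‖frame‖`. [folklore] -/
theorem lt_norm_Fband_sub_pZero {q : 𝔼 2} (hq : ‖q‖ < r) (hqA : κ * A' < ‖q‖) :
    9 * κ * ‖((b.frame hcross : (𝔼 3) ≃L[ℝ] 𝔼 3) : (𝔼 3) →L[ℝ] 𝔼 3)‖ < ‖b.Fband q - b.pZero‖ := by
  have h1 := b.le_norm_Fband_sub_pZero hcross h.flat hq
  have hbig := h.big
  have hε := h.eps_le_half
  set N := ‖((b.frame hcross : (𝔼 3) ≃L[ℝ] 𝔼 3) : (𝔼 3) →L[ℝ] 𝔼 3)‖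
  set M := ‖((b.frame hcross).symm : (𝔼 3) →L[ℝ] 𝔼 3)‖
  have hM : 0 < M := by
    apply norm_pos_iff.2
    intro h0
    have h3 : ((b.frame hcross).symm : (𝔼 3) →L[ℝ] 𝔼 3) (b.frame hcross (pt3 1 0 0)) = 0 := by
      rw [h0]; rfl
    rw [ContinuousLinearEquiv.coe_coe, ContinuousLinearEquiv.symm_apply_apply] at h3
    have := congrArg (fun Y : 𝔼 3 ↦ Y 0) h3
    simp at this
  -- `M ‖F q - p₀‖ ≥ (1 - ε) ‖q‖ > (1 - ε) κ A' > 9 κ N M`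
  have h2 : (1 - ε) * (κ * A') < (1 - ε) * ‖q‖ := mul_lt_mul_of_pos_left hqA (by linarith)
  have h3 : 9 * κ * N * M < (1 - ε) * (κ * A') := by
    have := mul_lt_mul_of_pos_left hbig h.κ_pos
    nlinarith
  by_contra hle
  push Not at hle
  have h4 : M * ‖b.Fband q - b.pZero‖ ≤ M * (9 * κ * N) := mul_le_mul_of_nonneg_left hle hM.le
  nlinarith

/-- **The spiked pieces avoid the rest of the necked loop.** [folklore] -/
theorem spikePiece_ne_neckPiece {u : ℝ} (hu : u ∈ Icc (0 : ℝ) 1) {s : ℝ} (hs : s ∈ b.spikeSet κ) {t : ℝ}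
    (ht : t ∈ Ico b.alo (b.alo + 1)) (hts : t ∉ b.spikeSet κ) :
    b.spikePiece hcross κ σ u s ≠ b.neckPiece κ 1 t := by
  obtain ⟨y, hPy, hy, hcase⟩ := b.spikePiece_eq_of_mem h hu hs
  rw [hPy]
  have hfarP := b.psiN_symm_not_mem_farSet h hy
  set ρ₁ := min r (min b.gapLo b.gapHi)
  have hρ₁r : ρ₁ ≤ r := min_le_left _ _
  have hρ₁lo : ρ₁ ≤ b.gapLo := (min_le_right _ _).trans (min_le_left _ _)
  have hρ₁hi : ρ₁ ≤ b.gapHi := (min_le_right _ _).trans (min_le_right _ _)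
  have hκ4 := h.κ_le_quarter
  have hκ0 := h.κ_pos
  intro hPQ
  -- if `Q` is in the far set we are done
  have hQfar : b.neckPiece κ 1 t ∉ b.farSet ρ₁ := fun hQ ↦ hfarP (hPQ ▸ hQ)
  by_cases hn : t ∈ b.neckSet
  swap
  · exact hQfar (b.neckPiece_mem_farSet_of_not_mem ρ₁ (Ico_subset_Icc_self ht) hn)
  -- common tools for the flat sub-cases
  have hA8 : κ * (7 + 1) < r := by linarith [h.eight_lt_r]
  have hsc7 : ∀ {α : ℝ}, |α| < 7 → κ * (|α| + 1) < r := fun {α} hα ↦ scale_of_abs_lt hκ0 h.eight_lt_r hα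
  have hscA : ∀ {α : ℝ}, |α| ≤ A' → κ * (|α| + 1) < r := fun {α} hα ↦ by nlinarith [h.scale_lt_r]
  have h56A : ∀ {α : ℝ}, |α| ≤ A' → ε * (|α| + 1) ≤ 5 / 6 := fun {α} hα ↦ by
    have := h.eps_le; have hε := h.flat.eps_nonneg; nlinarith
  have h7A : ∀ {α : ℝ}, |α| < 7 → |α| ≤ A' := fun {α} hα ↦ hα.le.trans h.seven_le
  rcases hn with hw | hw
  · -- `t` in the lower window
    by_cases hcore : t ∈ Ioo (b.tcLo - b.epsLo / 8) (b.tcLo + b.epsLo / 8)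
    swap
    · exact hQfar (b.neckPiece_mem_farSet_lowerWindow hκ4 hκ0 hρ₁lo hw hcore)
    have hcc := Ioo_subset_Icc_self hcore
    set q : 𝔼 2 := pt2 (κ * b.alphaLo κ t) (-κ)
    by_cases hqr : r ≤ ‖q‖
    · exact hQfar (b.neckPiece_mem_farSet_coreLo hκ4 hκ0 hcc (hρ₁r.trans hqr))
    push Not at hqr
    rw [b.neckPiece_eq_coreLo_flat h hcc hqr] at hPQ
    have hyq := coe_psiN_symm_injective hPQ
    -- `α t ∉ [-1, 6]` since `t ∉ S`
    have hαt : b.alphaLo κ t ∉ Icc (-1 : ℝ) 6 := fun hmem ↦ hts (Or.inl ⟨hcc, hmem⟩)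
    have hαt' : b.alphaLo κ t ∉ Ioo (1 / 8 : ℝ) 4 := fun hmem ↦ hαt ⟨by linarith [hmem.1], by linarith [hmem.2]⟩
    by_cases hαA : |b.alphaLo κ t| ≤ A'
    · -- within the blown-up range: compare pieces
      have hrail : b.railLoPsi κ (b.alphaLo κ t) = b.pieceLo hcross κ σ u (b.alphaLo κ t) :=
        (b.pieceLo_eq_rail hcross hαt').symm
      rcases hcase with ⟨hsc, hsα, rfl⟩ | ⟨hsc, hsα, rfl⟩
      · rw [hrail] at hyq
        have hA : κ * (A' + 1) < r := h.scale_lt_r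
        have e := b.injOn_pieceLo h.flat hκ0 hu σ hA h.good
          (show b.alphaLo κ s ∈ Icc (-A') A' from ⟨by linarith [hsα.1, h.seven_le], by linarith [hsα.2, h.seven_le]⟩)
          (abs_le.1 hαA) hyq
        have hst : s = t := (b.strictMonoOn_alphaLo hκ0).injOn hsc hcc e
        exact hts (hst ▸ Or.inl ⟨hsc, hsα⟩)
      · rw [hrail] at hyq
        exact b.pieceLo_ne_pieceHi h.flat hκ0 hu hu σ (hscA hαA) (hsc7 (b.abs_alphaHi_lt_of_mem hsα))
          (h56A hαA) (h56A (h7A (b.abs_alphaHi_lt_of_mem hsα))) hyq.symm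
    · -- beyond the blown-up range: quantitative separation
      push Not at hαA
      have hqA : κ * A' < ‖q‖ := by
        have := mul_abs_le_norm_railParam κ (b.alphaLo κ t) (-κ)
        rw [abs_of_pos hκ0] at this
        nlinarith
      have hlt := b.lt_norm_Fband_sub_pZero h hqr hqA
      have : b.Fband q = y := hyq.symm
      rw [this] at hlt
      linarith
  · -- `t` in the upper window
    by_cases hcore : t ∈ Ioo (b.tcHi - b.epsHi / 8) (b.tcHi + b.epsHi / 8)
    swap
    · exact hQfar (b.neckPiece_mem_farSet_upperWindow hκ4 hκ0 hρ₁hi hw hcore)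
    have hcc := Ioo_subset_Icc_self hcore
    set q : 𝔼 2 := pt2 (κ * b.alphaHi κ t) κ
    by_cases hqr : r ≤ ‖q‖
    · exact hQfar (b.neckPiece_mem_farSet_coreHi hκ4 hκ0 hcc (hρ₁r.trans hqr))
    push Not at hqr
    rw [b.neckPiece_eq_coreHi_flat h hcc hqr] at hPQ
    have hyq := coe_psiN_symm_injective hPQ
    have hαt : b.alphaHi κ t ∉ Icc (-1 : ℝ) 6 := fun hmem ↦ hts (Or.inr ⟨hcc, hmem⟩)
    have hαt' : b.alphaHi κ t ∉ Ioo (1 / 8 : ℝ) 4 := fun hmem ↦ hαt ⟨by linarith [hmem.1], by linarith [hmem.2]⟩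
    by_cases hαA : |b.alphaHi κ t| ≤ A'
    · have hrail : b.railHiPsi κ (b.alphaHi κ t) = b.pieceHi hcross κ σ u (b.alphaHi κ t) :=
        (b.pieceHi_eq_rail hcross hαt').symm
      rcases hcase with ⟨hsc, hsα, rfl⟩ | ⟨hsc, hsα, rfl⟩
      · rw [hrail] at hyq
        exact b.pieceLo_ne_pieceHi h.flat hκ0 hu hu σ (hsc7 (b.abs_alphaLo_lt_of_mem hsα)) (hscA hαA)
          (h56A (h7A (b.abs_alphaLo_lt_of_mem hsα))) (h56A hαA) hyq
      · rw [hrail] at hyq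
        have hA : κ * (A' + 1) < r := h.scale_lt_r
        have e := b.injOn_pieceHi h.flat hκ0 hu σ hA h.good
          (show b.alphaHi κ s ∈ Icc (-A') A' from ⟨by linarith [hsα.1, h.seven_le], by linarith [hsα.2, h.seven_le]⟩)
          (abs_le.1 hαA) hyq
        have hst : s = t := (b.strictAntiOn_alphaHi hκ0).injOn hsc hcc e
        exact hts (hst ▸ Or.inr ⟨hsc, hsα⟩)
    · push Not at hαA
      have hqA : κ * A' < ‖q‖ := by
        have := mul_abs_le_norm_railParam κ (b.alphaHi κ t) κ
        rw [abs_of_pos hκ0] at this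
        nlinarith
      have hlt := b.lt_norm_Fband_sub_pZero h hqr hqA
      have : b.Fband q = y := hyq.symm
      rw [this] at hlt
      linarith

end Scale

/-! ### The spiked loop, the spiked knot and the isotopy -/

/-- The necked piece function has the seam property of the rail piece function. [folklore] -/
theorem neckPiece_seam (κ : ℝ) : ∀ t ∈ Ioo (b.alo - b.seamEps) (b.alo + b.seamEps),
    b.neckPiece κ 1 (t + 1) = b.neckPiece κ 1 t :=
  seam_of_eqOn_compl b.railPiece_seam b.neckSet_subset fun _ ht ↦ b.neckPiece_eq_railPiece ht

/-- **The spiked loop**: the periodisation of the spiked piece function. [folklore] -/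
def spikeLoop (κ σ u : ℝ) : ℝ → 𝔼 4 := periodise b.alo (b.spikePiece hcross κ σ u)

section Knot

variable {hcross} {σ ε r A' κ : ℝ} (h : b.SpikeScale hcross σ ε r A' κ)
include h

/-- Off the spike set the spiked piece function is the necked one (scale form). [folklore] -/
theorem spikePiece_eq_neckPiece' (u : ℝ) {t : ℝ} (ht : t ∉ b.spikeSet κ) :
    b.spikePiece hcross κ σ u t = b.neckPiece κ 1 t :=
  b.spikePiece_eq_neckPiece hcross h.κ_pos h.seven_le_gapLo h.seven_le_gapHi σ u ht

/-- **The spiked loop is a regular loop** for `u ∈ [0, 1]`. [folklore] -/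
theorem isRegularLoop_spikeLoop {u : ℝ} (hu : u ∈ Icc (0 : ℝ) 1) : IsRegularLoop (b.spikeLoop hcross κ σ u) :=
  (b.isRegularLoop_neckLoop h.κ_le_quarter h.κ_pos ⟨zero_le_one, le_rfl⟩).periodise_of_eqOn_compl
    (b.contDiff_spikePiece_stage hcross h.κ_pos h.eight_le_poleRad σ u) b.seamEps_bounds.1 (b.neckPiece_seam κ)
    (b.spikeSet_subset κ) (b.isClosed_spikeSet κ) (fun _ ht ↦ b.spikePiece_eq_neckPiece' h u ht)
    (fun _ ht ↦ b.norm_spikePiece hcross h.κ_pos h.κ_le h.eight_le_poleRad σ u ht)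
    (fun _ ht ↦ b.deriv_spikePiece_ne_zero h.flat h.κ_pos h.κ_le h.eight_le_poleRad h.eight_lt_r
      h.seven_le_gapLo h.seven_le_gapHi h.good8 hu ht)

/-- **The spiked piece function is injective on the fundamental domain** for `u ∈ [0, 1]`.
[folklore] -/
theorem injOn_spikePiece_Ico (hAB : Disjoint (range A) (range B)) {u : ℝ} (hu : u ∈ Icc (0 : ℝ) 1) :
    InjOn (b.spikePiece hcross κ σ u) (Ico b.alo (b.alo + 1)) :=
  injOn_Ico_of_eqOn_compl (b.injOn_neckPiece_Ico hAB h.κ_le_quarter h.κ_pos ⟨zero_le_one, le_rfl⟩)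
    (fun _ ht ↦ b.spikePiece_eq_neckPiece' h u ht)
    (b.injOn_spikePiece h.flat h.κ_pos h.κ_le h.eight_le_poleRad h.eight_lt_r h.good8 h.eps8 hu)
    (fun _ hs _ ht hts ↦ b.spikePiece_ne_neckPiece h hu hs ht hts)

/-- **The spiked knot**: the knot of the spiked loop at `u = 1`. [folklore] -/
def spikeKnot (hAB : Disjoint (range A) (range B)) : Knot :=
  (b.isRegularLoop_spikeLoop h ⟨zero_le_one, le_rfl⟩).toKnot
    (periodise_simple_iff.2 (b.injOn_spikePiece_Ico h hAB ⟨zero_le_one, le_rfl⟩))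

/-- The spiked knot on the circle point of parameter `t`. [folklore] -/
theorem coe_spikeKnot_circlePt (hAB : Disjoint (range A) (range B)) (t : ℝ) :
    ((b.spikeKnot h hAB (circlePt t) : 𝕊 3) : 𝔼 4) = b.spikeLoop hcross κ σ 1 t :=
  (b.isRegularLoop_spikeLoop h ⟨zero_le_one, le_rfl⟩).coe_toKnot_circlePt _ t

/-- **The necked rail knot is isotopic to the spiked knot** (a smooth family of modifications on
the spike set; isotopy extension). [cite: HirschDT1976, Ch. 8 §1, Thm. 1.3] -/
theorem isIsotopic_neckKnot_spikeKnot (hAB : Disjoint (range A) (range B)) :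
    (b.neckKnot h.κ_le_quarter h.κ_pos hAB).IsIsotopic (b.spikeKnot h hAB) :=
  IsRegularLoop.isIsotopic_of_modification (G := b.spikePiece hcross κ σ)
    (b.isRegularLoop_neckLoop h.κ_le_quarter h.κ_pos ⟨zero_le_one, le_rfl⟩)
    (b.injOn_neckPiece_Ico hAB h.κ_le_quarter h.κ_pos ⟨zero_le_one, le_rfl⟩)
    (b.isRegularLoop_spikeLoop h ⟨zero_le_one, le_rfl⟩) (b.injOn_spikePiece_Ico h hAB ⟨zero_le_one, le_rfl⟩)
    b.seamEps_bounds.1 (b.neckPiece_seam κ) (b.contDiff_spikePiece hcross h.κ_pos h.eight_le_poleRad σ)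
    (b.spikeSet_subset κ) (b.isClosed_spikeSet κ) (fun u _ ht ↦ b.spikePiece_eq_neckPiece' h u ht)
    (b.spikePiece_zero hcross κ σ)
    (fun u _ _ ht ↦ b.norm_spikePiece hcross h.κ_pos h.κ_le h.eight_le_poleRad σ u ht)
    (fun _ hu _ ht ↦ b.deriv_spikePiece_ne_zero h.flat h.κ_pos h.κ_le h.eight_le_poleRad h.eight_lt_r
      h.seven_le_gapLo h.seven_le_gapHi h.good8 hu ht)
    (fun _ hu ↦ b.injOn_spikePiece h.flat h.κ_pos h.κ_le h.eight_le_poleRad h.eight_lt_r h.good8 h.eps8 hu)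
    (fun _ hu _ hs _ ht hts ↦ b.spikePiece_ne_neckPiece h hu hs ht hts)

/-- **The rail knot is isotopic to the spiked knot.** [cite: HirschDT1976, Ch. 8 §1, Thm. 1.3] -/
theorem isIsotopic_railKnot_spikeKnot (hAB : Disjoint (range A) (range B)) :
    (b.railKnot hAB).IsIsotopic (b.spikeKnot h hAB) :=
  IsAmbientIsotopic.trans_holds (b.isIsotopic_railKnot_neckKnot h.κ_le_quarter h.κ_pos hAB)
    (b.isIsotopic_neckKnot_spikeKnot h hAB)

end Knot

/-! ### The scale hypotheses hold for all small `κ` -/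

/-- **Existence of admissible scales**: for `|σ| ≤ 1` there are `ε, r, A'` such that every
sufficiently small `κ > 0` satisfies the scale hypotheses. [folklore] -/
theorem exists_spikeScale {σ : ℝ} (hσ : |σ| ≤ 1) :
    ∃ ε r A' κ₀ : ℝ, 0 < κ₀ ∧ ∀ κ, 0 < κ → κ ≤ κ₀ → b.SpikeScale hcross σ ε r A' κ := by
  set N := ‖((b.frame hcross : (𝔼 3) ≃L[ℝ] 𝔼 3) : (𝔼 3) →L[ℝ] 𝔼 3)‖
  set M := ‖((b.frame hcross).symm : (𝔼 3) →L[ℝ] 𝔼 3)‖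
  have hN : 0 ≤ N := norm_nonneg _
  have hM : 0 ≤ M := norm_nonneg _
  -- the blown-up range
  set A' : ℝ := 7 + 18 * N * M + 1 with hA'
  have hA7 : 7 ≤ A' := by have := mul_nonneg (mul_nonneg (by norm_num : (0:ℝ) ≤ 18) hN) hM; linarith
  have hA0 : 0 < A' + 1 := by linarith
  -- the tolerance
  obtain ⟨hB0, -⟩ := bumpBound_spec
  set ε : ℝ := min (1 / 2) (min (5 / (6 * (A' + 1))) (1 / (2 * (1 + bumpBound * (A' + 1))))) with hε
  have hε0 : 0 < ε := by
    refine lt_min (by norm_num) (lt_min (by positivity) (by positivity))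
  have hε1 : ε ≤ 1 / 2 := min_le_left _ _
  have hε2 : ε * (A' + 1) ≤ 5 / 6 := by
    have : ε ≤ 5 / (6 * (A' + 1)) := (min_le_right _ _).trans (min_le_left _ _)
    rw [le_div_iff₀ (by positivity)] at this; linarith
  have hε3 : ε * (1 + bumpBound * (A' + 1)) ≤ 1 / 2 := by
    have hpos : 0 < 1 + bumpBound * (A' + 1) := by positivity
    have : ε ≤ 1 / (2 * (1 + bumpBound * (A' + 1))) := (min_le_right _ _).trans (min_le_right _ _)
    rw [le_div_iff₀ (by positivity)] at this; linarith
  have hbig : 9 * N * M < (1 - ε) * A' := by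
    have h1 : (1 : ℝ) / 2 ≤ 1 - ε := by linarith
    have h2 : 9 * N * M < (1 / 2) * A' := by rw [hA']; nlinarith [mul_nonneg hN hM]
    nlinarith [mul_nonneg hN hM]
  -- the flatness radius
  obtain ⟨r, hf⟩ := b.exists_isFlat hcross hε0
  have hr := hf.r_pos
  -- the far distance and the continuity radius
  set ρ₁ := min r (min b.gapLo b.gapHi)
  have hρ₁ : 0 < ρ₁ := lt_min hr (lt_min b.gapLo_pos b.gapHi_pos)
  obtain ⟨m, hm, hfar⟩ := b.exists_farDist hρ₁
  have hcont : ContinuousAt (fun y : 𝔼 3 ↦ ((psiN.symm y : 𝕊 3) : 𝔼 4)) b.pZero :=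
    contDiff_coe_psiN_symm.continuous.continuousAt
  have hc0 : ((psiN.symm b.pZero : 𝕊 3) : 𝔼 4) = ((b.crossPt : 𝕊 3) : 𝔼 4) := by
    rw [b.pZero_eq, psiN_symm_apply_psiN (ne_northPole_of_nonpos (b.crossPt_last_eq_zero hcross).le)]
  obtain ⟨ρ₀, hρ₀, hball⟩ := Metric.continuousAt_iff.1 hcont m hm
  -- the scale bound
  set κ₀ : ℝ := min (1 / 12) (min (r / (2 * (A' + 1))) (min (b.gapLo / (A' + 1)) (min (b.gapHi / (A' + 1))
    (ρ₀ / (2 * (9 * N + 1)))))) with hκ₀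
  have hκ₀pos : 0 < κ₀ := by
    refine lt_min (by norm_num) (lt_min (by positivity) (lt_min (div_pos b.gapLo_pos hA0)
      (lt_min (div_pos b.gapHi_pos hA0) (by positivity))))
  refine ⟨ε, r, A', κ₀, hκ₀pos, fun κ hκ hκle ↦ ?_⟩
  have k1 : κ ≤ 1 / 12 := hκle.trans (min_le_left _ _)
  have k2 : κ ≤ r / (2 * (A' + 1)) := hκle.trans ((min_le_right _ _).trans (min_le_left _ _))
  have k3 : κ ≤ b.gapLo / (A' + 1) := hκle.trans ((min_le_right _ _).trans ((min_le_right _ _).trans (min_le_left _ _)))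
  have k4 : κ ≤ b.gapHi / (A' + 1) :=
    hκle.trans ((min_le_right _ _).trans ((min_le_right _ _).trans ((min_le_right _ _).trans (min_le_left _ _))))
  have k5 : κ ≤ ρ₀ / (2 * (9 * N + 1)) :=
    hκle.trans ((min_le_right _ _).trans ((min_le_right _ _).trans ((min_le_right _ _).trans (min_le_right _ _))))
  rw [le_div_iff₀ (by positivity)] at k2 k5
  rw [le_div_iff₀ hA0] at k3 k4
  refine ⟨hf, hκ, k1, hσ, hA7, by nlinarith, k3, k4, hε3, hε2, hbig, m, ρ₀, hfar, fun y hy ↦ ?_, ?_⟩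
  · have := hball (by rwa [dist_eq_norm])
    rwa [dist_eq_norm, hc0] at this
  · nlinarith [mul_nonneg hκ.le hN]

end BandData

end Literature.Topology.FourManifolds
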